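import Mathlib
import Summits.MatrixMultiplication.MatrixMultiplication.Theorems.SnSubsetDichotomyPolynomialSlackPermBernstein

/-!
# The cost of avoiding a weighted block

Crux `Summit.MatrixMultiplication.MatrixMultiplication.Theses.SnSubsetDichotomy.PolynomialSlack`
(item `stmt-MatrixMultiplication-8306`), level-one programme, line transport-split-hull, lead c7
(dyadic hub lemma, COST step). For a non-empty `A ⊆ S_n` and a block `J × I ⊆ Fin n × Fin n` carrying
weights `w_T ∈ [β, ρβ]` on `J` and `w_S ∈ [γ, ργ]` on `I`, the weighted hit statistic
`h(a) = Σ_{j ∈ J, a j ∈ I} w_T(j)·w_S(a j)` has uniform mean `E = (Σ_J w_T)(Σ_I w_S)/n` over `S_n`; if its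
`A`-average is at most `E/2`, then the block is small:

  `|J|·|I| ≤ 600·ρ⁴·(1 + log n)·n·log(6·n!/|A|)`      (`block_cost`).

Proof: Markov (`h ≥ 0`) gives `|A|/3` elements of `A` with `h ≤ 3E/4`, hence with `|h - E| ≥ E/4`; the
tree's Bernstein inequality for randomly permuted sums (`card_permutedSum_tail_le`, array
`a(x, y) = w_T(x)·w_S(y)·[x ∈ J][y ∈ I]`, range `ρ²βγ`, `Σ a² ≤ ρ²βγ·nE`, deviation `E/4`) bounds the number
of such permutations by `2·n!·exp(-|J||I|/(544ρ²(1 + log n)n))`; take logarithms.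
-/

namespace Summit.MatrixMultiplication.MatrixMultiplication.Theorems.PolynomialSlack

set_option linter.dupNamespace false

open scoped BigOperators

/-- Markov step: if `f ≥ 0` on `A` has `A`-sum at most `|A|·E/2` (`E > 0`), then at least a third of
the elements of `A` satisfy `f ≤ 3E/4`. -/
private theorem card_le_three_mul_card_filter_le {α : Type*} (A : Finset α) (f : α → ℝ) (E : ℝ)
    (hE : 0 < E) (hf : ∀ a ∈ A, 0 ≤ f a) (hsum : ∑ a ∈ A, f a ≤ A.card * E / 2) :
    (A.card : ℝ) ≤ 3 * ((A.filter fun a => f a ≤ 3 * E / 4).card : ℝ) := by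
  have hsplit := Finset.sum_filter_add_sum_filter_not A (fun a => f a ≤ 3 * E / 4) f
  have hcards : ((A.filter fun a => f a ≤ 3 * E / 4).card : ℝ) +
      ((A.filter fun a => ¬f a ≤ 3 * E / 4).card : ℝ) = A.card := by
    exact_mod_cast Finset.card_filter_add_card_filter_not (s := A) (fun a => f a ≤ 3 * E / 4)
  have h1 : 0 ≤ ∑ a ∈ A.filter (fun a => f a ≤ 3 * E / 4), f a :=
    Finset.sum_nonneg fun a ha => hf a (Finset.mem_filter.1 ha).1
  have h2 : 3 * E / 4 * ((A.filter fun a => ¬f a ≤ 3 * E / 4).card : ℝ) ≤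
      ∑ a ∈ A.filter (fun a => ¬f a ≤ 3 * E / 4), f a := by
    have h : ∑ _a ∈ A.filter (fun a => ¬f a ≤ 3 * E / 4), 3 * E / 4 ≤
        ∑ a ∈ A.filter (fun a => ¬f a ≤ 3 * E / 4), f a :=
      Finset.sum_le_sum fun a ha => (not_le.1 (Finset.mem_filter.1 ha).2).le
    rwa [Finset.sum_const, nsmul_eq_mul, mul_comm] at h
  have h3 : E * (3 * ((A.filter fun a => ¬f a ≤ 3 * E / 4).card : ℝ)) ≤ E * (2 * A.card) := by
    linarith
  have h4 := le_of_mul_le_mul_left h3 hE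
  linarith

/-- Taking logarithms: `c/3 ≤ 2F·exp(-K)` with `c, F > 0` forces `K ≤ log(6F/c)`. -/
private theorem le_log_of_third_le_exp {c F K : ℝ} (hc : 0 < c) (hF : 0 < F)
    (h : c / 3 ≤ 2 * F * Real.exp (-K)) : K ≤ Real.log (6 * F / c) := by
  rw [Real.le_log_iff_exp_le (by positivity), le_div_iff₀ hc]
  rw [Real.exp_neg, le_mul_inv_iff₀ (Real.exp_pos K)] at h
  linarith

/-- **Block cost.** Let `A ⊆ S_n` be non-empty (`n ≥ 1`), `J, I ⊆ Fin n` blocks with weights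
`w_T ∈ [β, ρβ]` on `J` and `w_S ∈ [γ, ργ]` on `I` (`β, γ > 0`, `ρ ≥ 1`). If the weighted hit statistic
`h(a) = Σ_{j ∈ J, a j ∈ I} w_T(j)·w_S(a j)` has `A`-average at most HALF its uniform average
`E = (Σ_J w_T)(Σ_I w_S)/n`, then `|J|·|I| ≤ 600·ρ⁴·(1 + log n)·n·log(6·n!/|A|)`.
Proof: at least `|A|/3` elements of `A` have `h ≤ 3E/4` (Markov), and `card_permutedSum_tail_le`
(deviation `E/4`, `Σ a² ≤ ρ²βγ·nE`, range `ρ²βγ`) bounds the number of such permutations by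
`2·n!·exp(-|J||I|/(544ρ²(1 + log n)n))`. [folklore] -/
theorem block_cost {n : ℕ} (hn : 1 ≤ n) (A : Finset (Equiv.Perm (Fin n))) (hA : A.Nonempty)
    (J I : Finset (Fin n)) (wT wS : Fin n → ℝ) (β γ ρ : ℝ) (hβ : 0 < β) (hγ : 0 < γ) (hρ : 1 ≤ ρ)
    (hwT : ∀ j ∈ J, β ≤ wT j ∧ wT j ≤ ρ * β) (hwS : ∀ i ∈ I, γ ≤ wS i ∧ wS i ≤ ρ * γ)
    (hdef : ∑ a ∈ A, ∑ j ∈ J, (if a j ∈ I then wT j * wS (a j) else 0) ≤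
      (A.card : ℝ) * ((∑ j ∈ J, wT j) * (∑ i ∈ I, wS i) / n) / 2) :
    (J.card : ℝ) * I.card ≤ 600 * ρ ^ 4 * (1 + Real.log n) * n * Real.log (6 * n.factorial / A.card) := by
  -- positivity bookkeeping
  have hnR : (1 : ℝ) ≤ n := by exact_mod_cast hn
  have hn0 : (0 : ℝ) < n := by linarith
  have hρpos : 0 < ρ := by linarith
  have hAc0 : (0 : ℝ) < A.card := by exact_mod_cast hA.card_pos
  have hf0 : (0 : ℝ) < n.factorial := by exact_mod_cast n.factorial_pos
  have hAle : (A.card : ℝ) ≤ n.factorial := by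
    have h : A.card ≤ Fintype.card (Equiv.Perm (Fin n)) := Finset.card_le_univ _
    rw [Fintype.card_perm, Fintype.card_fin] at h
    exact_mod_cast h
  have hL0 : 0 ≤ Real.log (6 * n.factorial / A.card) := by
    refine Real.log_nonneg ?_
    rw [le_div_iff₀ hAc0]
    linarith only [hAle, hf0]
  have hG1 : 1 ≤ 1 + Real.log n := by linarith only [Real.log_nonneg hnR]
  have hG0 : 0 ≤ 1 + Real.log n := by linarith only [hG1]
  -- the degenerate case `J = ∅ ∨ I = ∅`
  rcases eq_or_ne ((J.card : ℝ) * I.card) 0 with h0 | h0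
  · rw [h0]; positivity
  obtain ⟨hJ0, hI0⟩ := mul_ne_zero_iff.1 h0
  have hJpos : (0 : ℝ) < J.card := lt_of_le_of_ne (Nat.cast_nonneg _) (Ne.symm hJ0)
  have hIpos : (0 : ℝ) < I.card := lt_of_le_of_ne (Nat.cast_nonneg _) (Ne.symm hI0)
  -- the block weights extended by zero; `P`, `Q` and the uniform mean `E`
  set P : ℝ := ∑ j ∈ J, wT j with hP
  set Q : ℝ := ∑ i ∈ I, wS i with hQ
  set E : ℝ := P * Q / n with hE
  set u : Fin n → ℝ := fun x => if x ∈ J then wT x else 0 with hu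
  set v : Fin n → ℝ := fun y => if y ∈ I then wS y else 0 with hv
  have hu_apply : ∀ x, u x = if x ∈ J then wT x else 0 := fun x => rfl
  have hv_apply : ∀ y, v y = if y ∈ I then wS y else 0 := fun y => rfl
  have hu0 : ∀ x, 0 ≤ u x := fun x => by
    by_cases hx : x ∈ J
    · rw [hu_apply, if_pos hx]; linarith only [(hwT x hx).1, hβ]
    · rw [hu_apply, if_neg hx]
  have hule : ∀ x, u x ≤ ρ * β := fun x => by
    by_cases hx : x ∈ J
    · rw [hu_apply, if_pos hx]; exact (hwT x hx).2
    · rw [hu_apply, if_neg hx]; exact (mul_pos hρpos hβ).le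
  have hv0 : ∀ y, 0 ≤ v y := fun y => by
    by_cases hy : y ∈ I
    · rw [hv_apply, if_pos hy]; linarith only [(hwS y hy).1, hγ]
    · rw [hv_apply, if_neg hy]
  have hvle : ∀ y, v y ≤ ρ * γ := fun y => by
    by_cases hy : y ∈ I
    · rw [hv_apply, if_pos hy]; exact (hwS y hy).2
    · rw [hv_apply, if_neg hy]; exact (mul_pos hρpos hγ).le
  have husq : ∀ x, u x ^ 2 ≤ ρ * β * u x := fun x => by
    by_cases hx : x ∈ J
    · rw [hu_apply, if_pos hx]
      nlinarith only [(hwT x hx).1, (hwT x hx).2, hβ]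
    · rw [hu_apply, if_neg hx]; simp
  have hvsq : ∀ y, v y ^ 2 ≤ ρ * γ * v y := fun y => by
    by_cases hy : y ∈ I
    · rw [hv_apply, if_pos hy]
      nlinarith only [(hwS y hy).1, (hwS y hy).2, hγ]
    · rw [hv_apply, if_neg hy]; simp
  have hsumu : ∑ x, u x = P := by rw [hP]; exact Fintype.sum_extend_by_zero J wT
  have hsumv : ∑ y, v y = Q := by rw [hQ]; exact Fintype.sum_extend_by_zero I wS
  -- lower bounds on `P`, `Q`; positivity of `E`
  have hPge : β * J.card ≤ P := by
    have h := Finset.sum_le_sum fun j hj => (hwT j hj).1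
    rw [Finset.sum_const, nsmul_eq_mul] at h
    rw [hP]; linarith only [h]
  have hQge : γ * I.card ≤ Q := by
    have h := Finset.sum_le_sum fun i hi => (hwS i hi).1
    rw [Finset.sum_const, nsmul_eq_mul] at h
    rw [hQ]; linarith only [h]
  have hP0 : 0 < P := lt_of_lt_of_le (mul_pos hβ hJpos) hPge
  have hQ0 : 0 < Q := lt_of_lt_of_le (mul_pos hγ hIpos) hQge
  have hE0 : 0 < E := by rw [hE]; exact div_pos (mul_pos hP0 hQ0) hn0
  have hnE : (n : ℝ) * E = P * Q := by rw [hE]; field_simp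
  have hEge : β * γ * (J.card * I.card) ≤ n * E := by
    rw [hnE]
    calc β * γ * (J.card * I.card) = β * J.card * (γ * I.card) := by ring
      _ ≤ P * Q := mul_le_mul hPge hQge (mul_nonneg hγ.le hIpos.le) hP0.le
  -- the statistic `h(π) = Σ_x u x · v (π x)`, its mean `E` and its second moment
  have hstat : ∀ π : Equiv.Perm (Fin n),
      ∑ x, u x * v (π x) = ∑ j ∈ J, (if π j ∈ I then wT j * wS (π j) else 0) := by
    intro π
    rw [← Fintype.sum_extend_by_zero J]
    refine Finset.sum_congr rfl fun x _ => ?_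
    by_cases hx : x ∈ J <;> by_cases hy : π x ∈ I <;> simp [hu_apply, hv_apply, hx, hy]
  have hmean : (∑ x, ∑ y, u x * v y) / n = E := by
    rw [← Fintype.sum_mul_sum, hsumu, hsumv, hE]
  have hm : ∀ x y, |u x * v y| ≤ ρ ^ 2 * β * γ := fun x y => by
    rw [abs_mul, abs_of_nonneg (hu0 x), abs_of_nonneg (hv0 y)]
    calc u x * v y ≤ ρ * β * (ρ * γ) :=
          mul_le_mul (hule x) (hvle y) (hv0 y) (mul_pos hρpos hβ).le
      _ = ρ ^ 2 * β * γ := by ring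
  have hsq : ∑ x, ∑ y, (u x * v y) ^ 2 ≤ ρ ^ 2 * β * γ * (P * Q) := by
    have e1 : ∑ x, ∑ y, (u x * v y) ^ 2 = (∑ x, u x ^ 2) * ∑ y, v y ^ 2 := by
      rw [Fintype.sum_mul_sum]
      exact Finset.sum_congr rfl fun x _ => Finset.sum_congr rfl fun y _ => by ring
    have e2 : ∑ x, u x ^ 2 ≤ ρ * β * P := by
      calc ∑ x, u x ^ 2 ≤ ∑ x, ρ * β * u x := Finset.sum_le_sum fun x _ => husq x
        _ = ρ * β * P := by rw [← Finset.mul_sum, hsumu]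
    have e3 : ∑ y, v y ^ 2 ≤ ρ * γ * Q := by
      calc ∑ y, v y ^ 2 ≤ ∑ y, ρ * γ * v y := Finset.sum_le_sum fun y _ => hvsq y
        _ = ρ * γ * Q := by rw [← Finset.mul_sum, hsumv]
    have e4 : 0 ≤ ∑ y, v y ^ 2 := Finset.sum_nonneg fun y _ => sq_nonneg _
    rw [e1]
    calc (∑ x, u x ^ 2) * ∑ y, v y ^ 2 ≤ ρ * β * P * (ρ * γ * Q) :=
          mul_le_mul e2 e3 e4 (mul_nonneg (mul_pos hρpos hβ).le hP0.le)
      _ = ρ ^ 2 * β * γ * (P * Q) := by ring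
  have hsq0 : 0 ≤ ∑ x, ∑ y, (u x * v y) ^ 2 :=
    Finset.sum_nonneg fun x _ => Finset.sum_nonneg fun y _ => sq_nonneg _
  -- Bernstein for permuted sums, deviation `E/4`
  have hB := card_permutedSum_tail_le (n := n) (ρ ^ 2 * β * γ) (fun x y => u x * v y) hm (E / 4)
    (by linarith only [hE0])
  rw [hmean] at hB
  -- the exponent dominates `K = |J||I|/(544ρ²(1 + log n)n)`
  have hm0 : 0 < ρ ^ 2 * β * γ := mul_pos (mul_pos (pow_pos hρpos 2) hβ) hγ
  set D : ℝ := 32 * (1 + Real.log n) * (∑ x, ∑ y, (u x * v y) ^ 2) / n +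
    8 * (ρ ^ 2 * β * γ) * (E / 4) with hD
  have hD0 : 0 < D := by
    have h1 : 0 ≤ 32 * (1 + Real.log n) * (∑ x, ∑ y, (u x * v y) ^ 2) / n :=
      div_nonneg (mul_nonneg (by linarith only [hG0]) hsq0) hn0.le
    have h2 : 0 < 8 * (ρ ^ 2 * β * γ) * (E / 4) := by nlinarith only [hm0, hE0]
    rw [hD]; linarith only [h1, h2]
  have hDle : D ≤ 34 * (1 + Real.log n) * (ρ ^ 2 * β * γ) * E := by
    have h1 : 32 * (1 + Real.log n) * (∑ x, ∑ y, (u x * v y) ^ 2) / n ≤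
        32 * (1 + Real.log n) * (ρ ^ 2 * β * γ) * E := by
      rw [div_le_iff₀ hn0]
      calc 32 * (1 + Real.log n) * (∑ x, ∑ y, (u x * v y) ^ 2)
          ≤ 32 * (1 + Real.log n) * (ρ ^ 2 * β * γ * (P * Q)) :=
            mul_le_mul_of_nonneg_left hsq (by linarith only [hG0])
        _ = 32 * (1 + Real.log n) * (ρ ^ 2 * β * γ) * E * n := by rw [← hnE]; ring
    have h2 : 8 * (ρ ^ 2 * β * γ) * (E / 4) ≤ 2 * (1 + Real.log n) * (ρ ^ 2 * β * γ) * E := by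
      have h := mul_le_mul_of_nonneg_right hG1 (mul_nonneg hm0.le hE0.le)
      linarith only [h]
    rw [hD]; linarith only [h1, h2]
  have hden : (0 : ℝ) < 544 * ρ ^ 2 * (1 + Real.log n) * n := by positivity
  set K : ℝ := J.card * I.card / (544 * ρ ^ 2 * (1 + Real.log n) * n) with hK
  have hK0 : 0 ≤ K := by
    rw [hK]; exact div_nonneg (mul_nonneg hJpos.le hIpos.le) hden.le
  have hKexp : K ≤ (E / 4) ^ 2 / D := by
    rw [le_div_iff₀ hD0]
    have h1 : K * D ≤ K * (34 * (1 + Real.log n) * (ρ ^ 2 * β * γ) * E) :=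
      mul_le_mul_of_nonneg_left hDle hK0
    have h2 : K * (34 * (1 + Real.log n) * (ρ ^ 2 * β * γ) * E) * (16 * n) =
        β * γ * (J.card * I.card) * E := by
      rw [hK, div_mul_eq_mul_div, div_mul_eq_mul_div, div_eq_iff hden.ne']
      ring
    have h3 : β * γ * (J.card * I.card) * E ≤ (E / 4) ^ 2 * (16 * n) := by
      have h := mul_le_mul_of_nonneg_right hEge hE0.le
      nlinarith only [h]
    have h4 : K * (34 * (1 + Real.log n) * (ρ ^ 2 * β * γ) * E) * (16 * n) ≤
        (E / 4) ^ 2 * (16 * n) := by rw [h2]; exact h3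
    have h5 := le_of_mul_le_mul_right h4 (by linarith only [hn0])
    exact h1.trans h5
  -- Markov: a third of `A` deviates from the mean by at least `E/4`
  have hW0 : ∀ a ∈ A, 0 ≤ ∑ x, u x * v (a x) := fun a _ =>
    Finset.sum_nonneg fun x _ => mul_nonneg (hu0 x) (hv0 _)
  have hsumA : ∑ a ∈ A, ∑ x, u x * v (a x) ≤ A.card * E / 2 := by
    have hrw : ∑ a ∈ A, ∑ x, u x * v (a x) =
        ∑ a ∈ A, ∑ j ∈ J, (if a j ∈ I then wT j * wS (a j) else 0) :=
      Finset.sum_congr rfl fun a _ => hstat a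
    rw [hrw]; exact hdef
  have hthird := card_le_three_mul_card_filter_le A (fun a => ∑ x, u x * v (a x)) E hE0 hW0 hsumA
  have hBsub : (A.filter fun a => ∑ x, u x * v (a x) ≤ 3 * E / 4) ⊆
      (Finset.univ.filter fun π : Equiv.Perm (Fin n) => E / 4 ≤ |∑ x, u x * v (π x) - E|) := by
    intro a ha
    rw [Finset.mem_filter] at ha ⊢
    exact ⟨Finset.mem_univ _, le_abs.2 (Or.inr (by linarith only [ha.2]))⟩
  have hchain : (A.card : ℝ) / 3 ≤ 2 * (n.factorial : ℝ) * Real.exp (-K) := by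
    calc (A.card : ℝ) / 3 ≤ ((A.filter fun a => ∑ x, u x * v (a x) ≤ 3 * E / 4).card : ℝ) := by
          linarith only [hthird]
      _ ≤ ((Finset.univ.filter fun π : Equiv.Perm (Fin n) =>
            E / 4 ≤ |∑ x, u x * v (π x) - E|).card : ℝ) := by
          exact_mod_cast Finset.card_le_card hBsub
      _ ≤ 2 * (n.factorial : ℝ) * Real.exp (-((E / 4) ^ 2 / D)) := hB
      _ ≤ 2 * (n.factorial : ℝ) * Real.exp (-K) :=
          mul_le_mul_of_nonneg_left (Real.exp_le_exp.2 (neg_le_neg hKexp)) (by positivity)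
  -- take logarithms
  have hKL : K ≤ Real.log (6 * n.factorial / A.card) := le_log_of_third_le_exp hAc0 hf0 hchain
  have hJI : (J.card : ℝ) * I.card ≤
      Real.log (6 * n.factorial / A.card) * (544 * ρ ^ 2 * (1 + Real.log n) * n) := by
    have h := hKL
    rw [hK, div_le_iff₀ hden] at h
    exact h
  have hρ24 : ρ ^ 2 ≤ ρ ^ 4 := by
    calc ρ ^ 2 = ρ ^ 2 * 1 := by ring
      _ ≤ ρ ^ 2 * ρ ^ 2 := mul_le_mul_of_nonneg_left (one_le_pow₀ hρ) (sq_nonneg ρ)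
      _ = ρ ^ 4 := by ring
  have hGnL : 0 ≤ (1 + Real.log n) * n * Real.log (6 * n.factorial / A.card) :=
    mul_nonneg (mul_nonneg hG0 hn0.le) hL0
  calc (J.card : ℝ) * I.card
      ≤ Real.log (6 * n.factorial / A.card) * (544 * ρ ^ 2 * (1 + Real.log n) * n) := hJI
    _ = 544 * ρ ^ 2 * ((1 + Real.log n) * n * Real.log (6 * n.factorial / A.card)) := by ring
    _ ≤ 600 * ρ ^ 4 * ((1 + Real.log n) * n * Real.log (6 * n.factorial / A.card)) := by
        refine mul_le_mul ?_ le_rfl hGnL (by positivity)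
        linarith only [hρ24, pow_nonneg hρpos.le 4]
    _ = 600 * ρ ^ 4 * (1 + Real.log n) * n * Real.log (6 * n.factorial / A.card) := by ring

end Summit.MatrixMultiplication.MatrixMultiplication.Theorems.PolynomialSlack
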